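import Summits.ResolutionOfSingularities.ResolutionOfSingularities.Theorems.RadicialJungCleanModelsNSCoordinateLiftRsop
import Summits.ResolutionOfSingularities.ResolutionOfSingularities.Theorems.RadicialJungCleanModelsNSCoordinateLiftCompanion
import Summits.ResolutionOfSingularities.ResolutionOfSingularities.Theorems.RadicialJungCleanModelsNSUnitNormalization
import Summits.ResolutionOfSingularities.ResolutionOfSingularities.Theorems.RadicialJungCleanModelsNSResidueLocAtCentre
import HarnessLib

/-!
# ONE STEP of the residue-side transport: a coordinate blowing up of the residue ring, LIFTED to the model with all invariants kept

Route `RadicialJung`, crux `CleanModels` (stmt-ResolutionOfSingularities-15917), registered skeleton `Cruxes/CleanModels/Lines/Sketch.lean`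
rev 35 (sha16 de44649d8f729c3b), stub 7 `stub_cleanModelsDimGEFour`.  Explicit-unit seat `decomp-res-hand-2` g5 (structural hand); memo
`Cruxes/CleanModels/Lines/Sketch-memo-hand2-g5-stubs-5-7.md` §3 (step (S5) of the assembly).  OURS; structural bookkeeping, counted 0; nothing here
proves resolution of singularities in characteristic `p`.

`liftStep_of_isRsopPart` — THE INDUCTION STEP of the assembly `spec_localMonomialization_four_of_rankOne` (g5 spec).  INVARIANT (input and
output): a finitely generated model `A ⊆ O` whose centre of `ν₁` is `(Y) · A` on the nose, together with an identification
`ρ(locAtCentre A O) = S` of the residues (in `κ(O₁)`) of its local ring at the centre of `ν` with a residue-side local ring `S`.  DATA: a family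
`(z̄₀, z̄₁, …, z̄_s)` in `S` that is PART OF A REGULAR SYSTEM OF PARAMETERS of `S`, `z̄₀` of positive and `ν̄`-minimal value.  OUTPUT: a model
`A ⊆ A⁺ ⊆ O` (f.g.) with the SAME local ring at the centre of `ν₁`, centre of `ν₁` equal to `(Y/z₀) · A⁺` for a lift `z₀ ∈ A` of `z̄₀` (up to the
residue of a `ν`-unit `E ∈ A`), `#(Y/z₀) = #Y`, and `ρ(locAtCentre A⁺ O) = locAtCentre (S[z̄_l / z̄₀]) Ō` — the residue-side coordinate blowing up.
Composition of ✓ `centre_locAtCentre_adjoin_div_le_map` (via ✓ `IsRsopPart.isQuasiRegular`, ✓ `IsQuasiRegular.map_ringEquiv`),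
✓ `locGen_of_centre_le_map`, ✓ `locGen_sup_adjoin_div`, ✓ `exists_model_centre_eq_span_of_local`, ✓ `range_residue_locAtCentre`.
[cite: NovacoskiSpivakovsky2014, §3.2] [cite: Matsumura1987, Thm. 16.2 (i)]
-/

noncomputable section

set_option linter.dupNamespace false -- mandated namespace of this single-conjunct summit

open IsLocalRing
open Literature.AlgebraicGeometry.Resolution

namespace Summit.ResolutionOfSingularities.ResolutionOfSingularities.Theorems.RadicialJung.CleanModels

variable {k K : Type} [Field k] [Field K] [Algebra k K]

/-- Membership in the range of the residue map restricted to a subring of `O₁`. [folklore] -/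
theorem mem_range_residue_comp_inclusion_iff (O₁ : ValuationSubring K) (L : Subring K) (h : L ≤ O₁.toSubring)
    (x : ResidueField O₁) :
    x ∈ ((residue O₁).comp (Subring.inclusion h)).range ↔ ∃ (y : K) (hy : y ∈ L), residue O₁ ⟨y, h hy⟩ = x := by
  constructor
  · rintro ⟨y, rfl⟩; exact ⟨y, y.2, rfl⟩
  · rintro ⟨y, hy, rfl⟩; exact ⟨⟨y, hy⟩, rfl⟩

/-- Ranges of the residue map on EQUAL subrings coincide. [folklore] -/
theorem range_residue_comp_inclusion_congr (O₁ : ValuationSubring K) {L L' : Subring K} (hLL' : L = L')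
    (h : L ≤ O₁.toSubring) (h' : L' ≤ O₁.toSubring) :
    ((residue O₁).comp (Subring.inclusion h)).range = ((residue O₁).comp (Subring.inclusion h')).range := by
  subst hLL'; rfl

/-- **One lifted step.** See the module docstring. [cite: NovacoskiSpivakovsky2014, §3.2] [cite: Matsumura1987, Thm. 16.2 (i)] -/
theorem liftStep_of_isRsopPart (O O₁ : ValuationSubring K) (hO : O ≤ O₁)
    (A : Subalgebra k K) (hA : A.toSubring ≤ O.toSubring) (hAfg : A.FG)
    (Y : Finset A.toSubring)
    (hIY : (maximalIdeal O₁).comap (Subring.inclusion (hA.trans hO)) = Ideal.span (Y : Set A.toSubring))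
    (S : Subring (ResidueField O₁)) [IsLocalRing S]
    (hS : ((residue O₁).comp (Subring.inclusion ((locAtCentre_le hA).trans hO))).range = S)
    {s : ℕ} (zb : Fin (s + 1) → ResidueField O₁) (hzbS : ∀ i, zb i ∈ S)
    (hrsop : IsRsopPart (fun i => (⟨zb i, hzbS i⟩ : S)))
    (hzb₀ : (residueValuationSubring O O₁ hO).valuation (zb 0) < 1)
    (hmin : ∀ l : Fin s, (residueValuationSubring O O₁ hO).valuation (zb l.succ) ≤ (residueValuationSubring O O₁ hO).valuation (zb 0)) :
    ∃ (A' : Subalgebra k K) (hA' : A'.toSubring ≤ O.toSubring), A ≤ A' ∧ A'.FG ∧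
      locAtCentre A'.toSubring O₁ = locAtCentre A.toSubring O₁ ∧
      ∃ (z₀ : K) (E : K), z₀ ∈ A ∧ E ∈ A ∧ O.valuation E = 1 ∧ O.valuation z₀ < 1 ∧ O₁.valuation z₀ = 1 ∧
        (∃ hE : E ∈ O₁, ∃ hz : z₀ ∈ O₁, residue O₁ ⟨z₀, hz⟩ = zb 0 * residue O₁ ⟨E, hE⟩) ∧
      ∃ Y' : Finset A'.toSubring, Y'.card = Y.card ∧
        (∀ y' : A'.toSubring, y' ∈ Y' ↔ ∃ y ∈ Y, ((y : A.toSubring) : K) / z₀ = (y' : K)) ∧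
        (maximalIdeal O₁).comap (Subring.inclusion (hA'.trans hO)) = Ideal.span (Y' : Set A'.toSubring) ∧
        ((residue O₁).comp (Subring.inclusion ((locAtCentre_le hA').trans hO))).range =
          locAtCentre (Subring.closure ((S : Set (ResidueField O₁)) ∪ Set.range fun l : Fin s => zb l.succ / zb 0))
            (residueValuationSubring O O₁ hO) := by
  classical
  set Ō := residueValuationSubring O O₁ hO with hŌdef
  have hAO₁ : A.toSubring ≤ O₁.toSubring := hA.trans hO
  set L := locAtCentre A.toSubring O with hLdef
  have hLO : L ≤ O.toSubring := locAtCentre_le hA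
  have hLO₁ : L ≤ O₁.toSubring := hLO.trans hO
  haveI : IsLocalRing L := isLocalRing_locAtCentre hA
  set ρ : L →+* ResidueField O₁ := (residue O₁).comp (Subring.inclusion hLO₁) with hρdef
  have hρval : ∀ ℓ : L, ρ ℓ = residue O₁ ⟨(ℓ : K), hLO₁ ℓ.2⟩ := fun _ => rfl
  set PL : Ideal L := (maximalIdeal O₁).comap (Subring.inclusion hLO₁) with hPLdef
  have hmemPL : ∀ f : L, f ∈ PL ↔ O₁.valuation (f : K) < 1 := fun f => by
    rw [hPLdef, Ideal.mem_comap, ValuationSubring.valuation_lt_one_iff]; rfl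
  have hkerρ : ∀ f : L, ρ f = 0 ↔ f ∈ PL := fun f => by
    rw [hρval, residue_eq_zero_iff, hPLdef, Ideal.mem_comap]; rfl
  -- valuation helpers
  have hν₁_of_res_ne : ∀ (y : K) (hy : y ∈ O₁), residue O₁ ⟨y, hy⟩ ≠ 0 → O₁.valuation y = 1 := by
    intro y hy hne
    rw [Ne, residue_eq_zero_iff, ValuationSubring.valuation_lt_one_iff] at hne
    exact le_antisymm ((O₁.valuation_le_one_iff _).mpr hy) (not_lt.mp hne)
  -- (1) lifts `ℓ i ∈ L` of the `z̄ i`, with a common denominator `E`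
  have hlift : ∀ i, ∃ ℓ : L, ρ ℓ = zb i := fun i => by
    have : zb i ∈ ρ.range := by rw [hS]; exact hzbS i
    obtain ⟨ℓ, hℓ⟩ := this; exact ⟨ℓ, hℓ⟩
  choose ℓ hℓ using hlift
  have hfr : ∀ i, ∃ n e : K, n ∈ A ∧ e ∈ A ∧ O.valuation e = 1 ∧ ((ℓ i : L) : K) = n / e := fun i => by
    obtain ⟨n, hn, e, he, he1, h⟩ := (mem_locAtCentre_iff).mp (ℓ i).2
    exact ⟨n, e, hn, he, he1, h⟩
  choose nm dn hnmA hdnA hdn1 hℓeq using hfr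
  have hdn0 : ∀ i, dn i ≠ 0 := fun i => ne_zero_of_valuation_eq_one (hdn1 i)
  set E : K := ∏ i, dn i with hEdef
  have hEA : E ∈ A := A.prod_mem fun i _ => hdnA i
  have hE1 : O.valuation E = 1 := by rw [hEdef, map_prod]; exact Finset.prod_eq_one fun i _ => hdn1 i
  have hE0 : E ≠ 0 := ne_zero_of_valuation_eq_one hE1
  have hEO : E ∈ O := hA hEA
  have hEO₁ : E ∈ O₁ := hO hEO
  have hEL : E ∈ L := le_locAtCentre _ _ hEA
  -- the model lifts `z i := ℓ i * E ∈ A`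
  let z : Fin (s + 1) → K := fun i => ((ℓ i : L) : K) * E
  have hzA : ∀ i, z i ∈ A := by
    intro i
    have : z i = nm i * ∏ j ∈ Finset.univ.erase i, dn j := by
      simp only [z]
      rw [hℓeq i, hEdef, ← Finset.mul_prod_erase Finset.univ dn (Finset.mem_univ i)]
      field_simp [hdn0 i]
    rw [this]
    exact A.mul_mem (hnmA i) (A.prod_mem fun j _ => hdnA j)
  have hzO₁ : ∀ i, z i ∈ O₁ := fun i => hO (hA (hzA i))
  -- residues: `res (z i) = z̄ i * res E`
  have hEres1 : Ō.valuation (residue O₁ ⟨E, hEO₁⟩) = 1 := (valuation_eq_one_iff_residue O O₁ hO E hEO).mp hE1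
  have hEres0 : residue O₁ ⟨E, hEO₁⟩ ≠ 0 := ne_zero_of_valuation_eq_one hEres1
  have hzres : ∀ i, residue O₁ ⟨z i, hzO₁ i⟩ = zb i * residue O₁ ⟨E, hEO₁⟩ := by
    intro i
    have : (⟨z i, hzO₁ i⟩ : O₁) = ⟨((ℓ i : L) : K), hLO₁ (ℓ i).2⟩ * ⟨E, hEO₁⟩ := Subtype.ext rfl
    rw [this, map_mul, ← hρval, hℓ i]
  have hzb0ne : zb 0 ≠ 0 := fun h => hrsop.ne_zero 0 (Subtype.ext h)
  have hzres_ne : ∀ i, residue O₁ ⟨z i, hzO₁ i⟩ ≠ 0 := fun i => by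
    rw [hzres i]; exact mul_ne_zero (fun h => hrsop.ne_zero i (Subtype.ext h)) hEres0
  have hz₁ : ∀ i, O₁.valuation (z i) = 1 := fun i => hν₁_of_res_ne _ (hzO₁ i) (hzres_ne i)
  have hz0 : ∀ i, z i ≠ 0 := fun i => ne_zero_of_valuation_eq_one (hz₁ i)
  -- `ν(z 0) < 1`
  have hz₀Q : O.valuation (z 0) < 1 := by
    rw [valuation_lt_one_iff_residue O O₁ hO (z 0) (hA (hzA 0)), hzres 0, map_mul, hEres1, mul_one]
    exact hzb₀
  -- `ν(z l.succ) ≤ ν(z 0)`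
  have hminK : ∀ l : Fin s, O.valuation (z l.succ) ≤ O.valuation (z 0) := by
    intro l
    have hquotO₁ : z l.succ / z 0 ∈ O₁ := by
      rw [← O₁.valuation_le_one_iff, map_div₀, hz₁, hz₁, div_one]
    have hres : residue O₁ ⟨z l.succ / z 0, hquotO₁⟩ = zb l.succ / zb 0 := by
      rw [residue_div O₁ (z l.succ) (z 0) (hzO₁ _) (hzO₁ _) (hz₁ 0) hquotO₁, hzres, hzres, mul_div_mul_right _ _ hEres0]
    have hmemŌ : zb l.succ / zb 0 ∈ Ō := by
      rw [← Ō.valuation_le_one_iff, map_div₀]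
      exact div_le_one_of_le₀ (hmin l) zero_le
    have hquotO : z l.succ / z 0 ∈ O := by
      have := (residue_mem_residueValuationSubring_iff O O₁ hO ⟨z l.succ / z 0, hquotO₁⟩).mp (hres ▸ hmemŌ)
      exact this
    have : O.valuation (z l.succ / z 0) ≤ 1 := (O.valuation_le_one_iff _).mpr hquotO
    rw [map_div₀] at this
    exact (div_le_one₀ (by rw [Valuation.pos_iff]; exact hz0 0)).mp this
  -- (2) the ring isomorphism `L ⧸ 𝔭_L ≃+* S`
  have hρS : ∀ f : L, ρ f ∈ S := fun f => by rw [← hS]; exact ⟨f, rfl⟩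
  let ρS : L →+* S := ρ.codRestrict S hρS
  have hρSval : ∀ f : L, ((ρS f : S) : ResidueField O₁) = ρ f := fun _ => rfl
  have hkerle : ∀ a : L, a ∈ PL → ρS a = 0 := fun a ha => Subtype.ext ((hkerρ a).mpr ha)
  let φ : (L ⧸ PL) →+* S := Ideal.Quotient.lift PL ρS hkerle
  have hφmk : ∀ f : L, φ (Ideal.Quotient.mk PL f) = ρS f := fun f => Ideal.Quotient.lift_mk PL ρS hkerle
  have hφinj : Function.Injective φ := by
    rw [RingHom.injective_iff_ker_eq_bot, RingHom.ker_eq_bot_iff_eq_zero]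
    intro x hx
    obtain ⟨f, rfl⟩ := Ideal.Quotient.mk_surjective x
    rw [hφmk] at hx
    have : ρ f = 0 := by rw [← hρSval, hx]; rfl
    exact Ideal.Quotient.eq_zero_iff_mem.mpr ((hkerρ f).mp this)
  have hφsurj : Function.Surjective φ := by
    intro x
    have : (x : ResidueField O₁) ∈ ρ.range := by rw [hS]; exact x.2
    obtain ⟨f, hf⟩ := this
    exact ⟨Ideal.Quotient.mk PL f, by rw [hφmk]; exact Subtype.ext hf⟩
  let e : (L ⧸ PL) ≃+* S := RingEquiv.ofBijective φ ⟨hφinj, hφsurj⟩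
  have he_mk : ∀ f : L, e (Ideal.Quotient.mk PL f) = ρS f := fun f => by
    rw [RingEquiv.ofBijective_apply]; exact hφmk f
  -- (3) the family of lifts in `L` and its image under `e`: associated to `z̄`
  let zL : Fin (s + 1) → L := fun i => ⟨z i, le_locAtCentre _ _ (hzA i)⟩
  let uS : S := ⟨residue O₁ ⟨E, hEO₁⟩, hρS ⟨E, hEL⟩⟩
  have hEunitS : IsUnit uS := by
    have hEinvL : E⁻¹ ∈ L := inv_mem_locAtCentre hEL hE1
    refine IsUnit.of_mul_eq_one ⟨ρ ⟨E⁻¹, hEinvL⟩, hρS _⟩ (Subtype.ext ?_)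
    change residue O₁ ⟨E, hEO₁⟩ * residue O₁ ⟨E⁻¹, hLO₁ hEinvL⟩ = 1
    rw [← map_mul, ← map_one (residue O₁)]
    congr 1
    exact Subtype.ext (mul_inv_cancel₀ hE0)
  have hassoc : ∀ i, Associated (⟨zb i, hzbS i⟩ : S) (e (Ideal.Quotient.mk PL (zL i))) := by
    intro i
    have : e (Ideal.Quotient.mk PL (zL i)) = ⟨zb i, hzbS i⟩ * uS := by
      rw [he_mk]
      apply Subtype.ext
      change ρ (zL i) = zb i * residue O₁ ⟨E, hEO₁⟩
      rw [hρval]; exact hzres i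
    rw [this]
    exact associated_mul_unit_right _ _ hEunitS
  have hrsop' : IsRsopPart (fun i => e (Ideal.Quotient.mk PL (zL i))) := hrsop.of_associated hassoc
  have hcons : (Fin.cons (⟨z 0, le_locAtCentre _ _ (hzA 0)⟩ : L) (fun l => (⟨z l.succ, le_locAtCentre _ _ (hzA l.succ)⟩ : L)) :
      Fin (s + 1) → L) = zL := by
    funext i
    refine Fin.cases ?_ (fun l => ?_) i
    · simp only [Fin.cons_zero]; rfl
    · simp only [Fin.cons_succ]; rfl
  -- (4) the coordinate lift
  set A' := A ⊔ Algebra.adjoin k (Set.range fun l : Fin s => z l.succ / z 0) with hA'def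
  obtain ⟨hA'O, hA'fg, hα', hext⟩ := centre_locAtCentre_adjoin_div_le_map_of_isRsopPart O O₁ hO A hA hAfg (z 0)
    (fun l => z l.succ) (hzA 0) (fun l => hzA l.succ) hz₀Q (hz₁ 0) hminK e (by rw [hcons]; exact hrsop')
  have hAA' : A ≤ A' := le_sup_left
  have hAA'' : A.toSubring ≤ A'.toSubring := fun x hx => hAA' hx
  -- (5) local generation of the centre of `ν₁` on `A'` by `Y`
  have hlocA : ∀ π : A.toSubring, O₁.valuation (π : K) < 1 →
      ∃ s : A.toSubring, O.valuation (s : K) = 1 ∧ s * π ∈ Ideal.span (Y : Set A.toSubring) := by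
    intro π hπ
    refine ⟨1, by simp, ?_⟩
    rw [one_mul, ← hIY, Ideal.mem_comap, ValuationSubring.valuation_lt_one_iff]
    exact hπ
  have hlocA' := locGen_of_centre_le_map O O₁ hO A A' hA hAA'' Y hlocA hext
  set Y' : Finset A'.toSubring := Y.map ⟨Subring.inclusion hAA'', Subring.inclusion_injective hAA''⟩ with hY'def
  have hY'P : ∀ y' ∈ Y', O₁.valuation ((y' : A'.toSubring) : K) < 1 := by
    intro y' hy'
    obtain ⟨y, hy, rfl⟩ := Finset.mem_map.mp hy'
    have : y ∈ (maximalIdeal O₁).comap (Subring.inclusion hAO₁) := hIY ▸ Ideal.subset_span hy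
    rw [Ideal.mem_comap, ValuationSubring.valuation_lt_one_iff] at this
    exact this
  -- (6) adjoin `Y / z 0`
  set A'' := A' ⊔ Algebra.adjoin k ((fun y : A'.toSubring => (y : K) / z 0) '' (Y' : Set A'.toSubring)) with hA''def
  obtain ⟨hA''O, hA''fg, hα'', hres'', Y'', hcard'', hmemY'', hY''P, hloc''⟩ :=
    locGen_sup_adjoin_div O O₁ hO A' hA'O hA'fg Y' hY'P hlocA' (z 0) (hAA' (hzA 0)) (hz₁ 0)
  have hA'A'' : A' ≤ A'' := le_sup_left
  -- (7) unit-normalise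
  obtain ⟨Ap, hApO, hA''Ap, hApfg, hlocOp, hlocO₁p, Yp, hcardp, hmemYp, hIYp⟩ :=
    exists_model_centre_eq_span_of_local O O₁ hO A'' hA''O hA''fg Y'' hY''P hloc''
  -- (8) the residue ring of `Ap`
  have hA''O₁ : A''.toSubring ≤ O₁.toSubring := hA''O.trans hO
  set Tb : Set (ResidueField O₁) := Set.range fun l : Fin s => zb l.succ / zb 0 with hTbdef
  have hquot : ∀ l : Fin s, ∃ hq : z l.succ / z 0 ∈ O₁, residue O₁ ⟨z l.succ / z 0, hq⟩ = zb l.succ / zb 0 := by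
    intro l
    have hq : z l.succ / z 0 ∈ O₁ := by rw [← O₁.valuation_le_one_iff, map_div₀, hz₁, hz₁, div_one]
    refine ⟨hq, ?_⟩
    rw [residue_div O₁ (z l.succ) (z 0) (hzO₁ _) (hzO₁ _) (hz₁ 0) hq, hzres, hzres, mul_div_mul_right _ _ hEres0]
  have hquotA' : ∀ l : Fin s, z l.succ / z 0 ∈ A' := fun l =>
    (le_sup_right : Algebra.adjoin k _ ≤ A') (Algebra.subset_adjoin ⟨l, rfl⟩)
  set ρA'' : Subring (ResidueField O₁) := ((residue O₁).comp (Subring.inclusion hA''O₁)).range with hρA''def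
  set ρA : Subring (ResidueField O₁) := ((residue O₁).comp (Subring.inclusion hAO₁)).range with hρAdef
  -- (8a) `S = locAtCentre ρA Ō`
  have hSeq : S = locAtCentre ρA Ō := by
    rw [← hS]; exact range_residue_locAtCentre O O₁ hO A.toSubring hA
  -- (8b) `ρ(A'') ⊆ closure (S ∪ Tb)`
  have hρA''le : ρA'' ≤ Subring.closure ((S : Set (ResidueField O₁)) ∪ Tb) := by
    -- residues of `A''` are residues of `A'`; residues of `A'` lie in the closure
    have hk : ∀ c : k, algebraMap k K c ∈ O := fun c => hA (A.algebraMap_mem c)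
    let T : Subalgebra k K :=
      { carrier := {x | ∃ hx : x ∈ O₁, residue O₁ ⟨x, hx⟩ ∈ Subring.closure ((S : Set (ResidueField O₁)) ∪ Tb)}
        mul_mem' := by
          rintro a b ⟨ha, ha'⟩ ⟨hb, hb'⟩
          refine ⟨O₁.mul_mem _ _ ha hb, ?_⟩
          have : (⟨a * b, O₁.mul_mem _ _ ha hb⟩ : O₁) = ⟨a, ha⟩ * ⟨b, hb⟩ := rfl
          rw [this, map_mul]; exact Subring.mul_mem _ ha' hb'
        one_mem' := ⟨O₁.one_mem, by
          have : (⟨1, O₁.one_mem⟩ : O₁) = 1 := rfl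
          rw [this, map_one]; exact Subring.one_mem _⟩
        add_mem' := by
          rintro a b ⟨ha, ha'⟩ ⟨hb, hb'⟩
          refine ⟨O₁.add_mem _ _ ha hb, ?_⟩
          have : (⟨a + b, O₁.add_mem _ _ ha hb⟩ : O₁) = ⟨a, ha⟩ + ⟨b, hb⟩ := rfl
          rw [this, map_add]; exact Subring.add_mem _ ha' hb'
        zero_mem' := ⟨O₁.zero_mem, by
          have : (⟨0, O₁.zero_mem⟩ : O₁) = 0 := rfl
          rw [this, map_zero]; exact Subring.zero_mem _⟩
        algebraMap_mem' := fun c => ⟨hO (hk c), Subring.subset_closure (Or.inl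
          (hρS ⟨algebraMap k K c, le_locAtCentre _ _ (A.algebraMap_mem c)⟩))⟩ }
    have hA'T : A' ≤ T := by
      refine sup_le (fun x hx => ⟨hO (hA hx), Subring.subset_closure (Or.inl (hρS ⟨x, le_locAtCentre _ _ hx⟩))⟩)
        (Algebra.adjoin_le ?_)
      rintro _ ⟨l, rfl⟩
      obtain ⟨hq, hres⟩ := hquot l
      exact ⟨hq, by rw [hres]; exact Subring.subset_closure (Or.inr ⟨l, rfl⟩)⟩
    rintro _ ⟨x, rfl⟩
    obtain ⟨c, hc⟩ := hres'' x
    rw [hc]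
    obtain ⟨hcO₁, hcT⟩ := hA'T c.2
    exact hcT
  -- (8c) `closure (S ∪ Tb) ⊆ locAtCentre ρA'' Ō`
  have hρAle : ρA ≤ ρA'' := by
    rintro _ ⟨x, rfl⟩
    exact ⟨⟨(x : K), hA'A'' (hAA' x.2)⟩, rfl⟩
  have hclosle : Subring.closure ((S : Set (ResidueField O₁)) ∪ Tb) ≤ locAtCentre ρA'' Ō := by
    rw [Subring.closure_le]
    rintro x (hx | ⟨l, rfl⟩)
    · rw [hSeq] at hx
      exact locAtCentre_mono Ō hρAle hx
    · obtain ⟨hq, hres⟩ := hquot l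
      dsimp only
      rw [← hres]
      exact le_locAtCentre _ _ ⟨⟨z l.succ / z 0, hA'A'' (hquotA' l)⟩, rfl⟩
  have hρA''O : ρA'' ≤ Ō.toSubring := by
    rintro _ ⟨x, rfl⟩
    exact (residue_mem_residueValuationSubring_iff O O₁ hO _).mpr (hA''O x.2)
  have hlocEq : locAtCentre ρA'' Ō = locAtCentre (Subring.closure ((S : Set (ResidueField O₁)) ∪ Tb)) Ō := by
    refine locAtCentre_eq_of_mutual_le Ō ρA'' (Subring.closure ((S : Set (ResidueField O₁)) ∪ Tb)) ?_ hclosle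
    exact hρA''le.trans (le_locAtCentre _ _)
  -- (9) assemble
  refine ⟨Ap, hApO, hAA'.trans (hA'A''.trans hA''Ap), hApfg, by rw [hlocO₁p, hα'', hα'], z 0, E, hzA 0, hEA, hE1, hz₀Q, hz₁ 0,
    ⟨hEO₁, hzO₁ 0, hzres 0⟩, Yp, by rw [hcardp, hcard'', hY'def, Finset.card_map], ?_, hIYp, ?_⟩
  · intro yp
    rw [hmemYp]
    constructor
    · rintro ⟨y'', hy'', hyy⟩
      obtain ⟨y', hy', hy'y''⟩ := (hmemY'' y'').mp hy''
      obtain ⟨y, hy, rfl⟩ := Finset.mem_map.mp hy'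
      exact ⟨y, hy, by rw [← hyy, ← hy'y'']; rfl⟩
    · rintro ⟨y, hy, hyy⟩
      refine ⟨⟨((y : A.toSubring) : K) / z 0, ?_⟩, (hmemY'' _).mpr ⟨⟨(y : K), hAA'' y.2⟩, Finset.mem_map.mpr ⟨y, hy, rfl⟩, rfl⟩, hyy⟩
      exact (le_sup_right : Algebra.adjoin k _ ≤ A'') (Algebra.subset_adjoin ⟨⟨(y : K), hAA'' y.2⟩, Finset.mem_map.mpr ⟨y, hy, rfl⟩, rfl⟩)
  · rw [range_residue_comp_inclusion_congr O₁ hlocOp ((locAtCentre_le hApO).trans hO) ((locAtCentre_le hA''O).trans hO),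
      range_residue_locAtCentre O O₁ hO A''.toSubring hA''O, ← hρA''def, hlocEq]

end Summit.ResolutionOfSingularities.ResolutionOfSingularities.Theorems.RadicialJung.CleanModels

end
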